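import Literature.Dynamics.NBody.AlbouyKaloshin2012SymmetricSlices
import Literature.Dynamics.NBody.JensenLeykin2025Transfer
import Mathlib.Tactic
import HarnessLib

/-!
# Reflection-symmetric normalized central configurations of `(1,1,b,b,c)` are `T12` / `T1234` shaped

Topic `Literature/Dynamics/NBody`; `pub-smale6` cell, seat 1 gen 3. Companion of
`AlbouyKaloshin2012SymmetricSlices.lean` (the ansätze `t12Q`, `t1234Q`) and of the branch reductions
`AlbouyKaloshin2012SliceBranches*.lean`. It kernel-checks the elementary step used when the cell's
Gröbner computations on the `T12` / `T1234` slices are read as statements about ALL reflection-symmetric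
central configurations (cell file `pub-smale6-1/PAPER-INPUT.md` §8.1):

* `sum_smul_newtonForce_eq_zero`: action–reaction, `Σ_k m_k f_k = 0` for the right-hand side `f` of
  system (1) of [AlbouyKaloshin2012] p. 535 (`newtonForce`), for any masses and any configuration;
* `centerOfMass_eq_zero`: hence every solution of (1), in particular every positive normalized central
  configuration (Definition 1, p. 536), has `Σ_k m_k q_k = 0` — the centre of mass is the origin;
* `exists_t12Q_of_reflection`: if a positive normalized CC of `e32Masses b c = (1,1,b,b,c)` with
  `2 + 2b + c ≠ 0` is mapped to itself by the reflection `reflLine a β d` in a line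
  `{a x + β y = d}` (`a² + β² = 1`) exchanging bodies 1, 2 and fixing 3, 4, 5, then the line is the
  `y`-axis and `q = t12Q s t y₃ y₄ y₅`;
* `exists_t1234Q_of_reflection`: the same with the body pairs (1 2)(3 4) exchanged and 5 fixed gives
  `q = t1234Q a₁ t₁ a₃ t₃ t₅`.

Proof: the normalisation `y₁ = y₂` and `q₁ ≠ q₂` force the mirror line to be vertical, the fixed /
paired bodies then have abscissae symmetric about it, and `Σ m_k x_k = 0` puts it through the origin.
Elementary; no case is claimed beyond these two permutation types (the other types reduce to them by
renumbering bodies, which is not formalised here).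
-/

namespace Literature.Dynamics.NBody

open Finset

/-- Reflection of the plane in the line `{p | a·p.1 + β·p.2 = d}` (a Euclidean reflection when
`a² + β² = 1`). [folklore] -/
def reflLine (a β d : ℝ) (p : ℝ × ℝ) : ℝ × ℝ :=
  (p.1 - 2 * (a * p.1 + β * p.2 - d) * a, p.2 - 2 * (a * p.1 + β * p.2 - d) * β)

/-- Action–reaction for the right-hand side of system (1) of [AlbouyKaloshin2012] p. 535:
`Σ_k m_k f_k = 0`, for arbitrary real masses and configuration. [folklore] -/
theorem sum_smul_newtonForce_eq_zero {n : ℕ} (m : Fin n → ℝ) (q : Fin n → ℝ × ℝ) :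
    ∑ k, m k • newtonForce m q k = 0 := by
  classical
  set c : Fin n → Fin n → ℝ := fun k l => m k * (m l / Real.sqrt (sqDist (q k) (q l)) ^ 3) with hc
  have hsym : ∀ k l, c k l = c l k := by
    intro k l
    simp only [hc, sqDist_comm (q k) (q l)]
    ring
  have h1 : ∀ k, m k • newtonForce m q k = ∑ l, c k l • (q k - q l) := by
    intro k
    unfold newtonForce
    rw [Finset.smul_sum]
    have h0 : (fun l => c k l • (q k - q l)) k = 0 := by simp
    rw [← Finset.sum_erase (f := fun l => c k l • (q k - q l)) Finset.univ h0]
    apply Finset.sum_congr rfl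
    intro l _
    rw [smul_smul]
  have h2 : ∑ k, ∑ l, c k l • q l = ∑ k, ∑ l, c k l • q k := by
    rw [Finset.sum_comm]
    exact Finset.sum_congr rfl (fun k _ => Finset.sum_congr rfl (fun l _ => by rw [hsym]))
  calc ∑ k, m k • newtonForce m q k
      = ∑ k, ∑ l, c k l • (q k - q l) := Finset.sum_congr rfl (fun k _ => h1 k)
    _ = ∑ k, ∑ l, (c k l • q k - c k l • q l) := by simp only [smul_sub]
    _ = ∑ k, ∑ l, c k l • q k - ∑ k, ∑ l, c k l • q l := by
        simp only [Finset.sum_sub_distrib]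
    _ = 0 := by rw [h2, sub_self]

/-- The centre of mass of any solution of system (1) — in particular of every positive normalized
central configuration ([AlbouyKaloshin2012] Definition 1, p. 536) — is the origin: `Σ_k m_k q_k = 0`.
[cite: AlbouyKaloshin2012, p. 535 system (1)] -/
theorem centerOfMass_eq_zero {n : ℕ} {m : Fin n → ℝ} {q : Fin n → ℝ × ℝ}
    (h : IsPositiveNormalizedCC m q) : ∑ k, m k • q k = 0 := by
  have := sum_smul_newtonForce_eq_zero m q
  calc ∑ k, m k • q k = ∑ k, m k • newtonForce m q k :=
        Finset.sum_congr rfl (fun k _ => by rw [← h.2.1 k])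
    _ = 0 := this

/-- The `x`-component of the centre-of-mass identity for the masses `(1,1,b,b,c)`. [folklore] -/
theorem e32_sum_x_eq_zero {b c : ℝ} {q : Fin 5 → ℝ × ℝ}
    (h : IsPositiveNormalizedCC (e32Masses b c) q) :
    (q 0).1 + (q 1).1 + b * (q 2).1 + b * (q 3).1 + c * (q 4).1 = 0 := by
  have h0 := congrArg Prod.fst (centerOfMass_eq_zero h)
  rw [Fin.sum_univ_five] at h0
  have e0 : e32Masses b c 0 = 1 := rfl
  have e1 : e32Masses b c 1 = 1 := rfl
  have e2 : e32Masses b c 2 = b := rfl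
  have e3 : e32Masses b c 3 = b := rfl
  have e4 : e32Masses b c 4 = c := rfl
  rw [e0, e1, e2, e3, e4] at h0
  simp only [Prod.fst_add, Prod.smul_fst, smul_eq_mul, one_mul, Prod.fst_zero] at h0
  linarith

/-- A positive normalized central configuration of `(1,1,b,b,c)` (`2 + 2b + c ≠ 0`, e.g. positive
masses) that is mapped to itself by a reflection exchanging bodies 1, 2 and fixing bodies 3, 4, 5 is of
the `T12` shape: the mirror is the `y`-axis. [folklore] -/
theorem exists_t12Q_of_reflection {b c : ℝ} (hM : 2 + 2 * b + c ≠ 0) {q : Fin 5 → ℝ × ℝ}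
    (hq : IsPositiveNormalizedCC (e32Masses b c) q) {a β d : ℝ} (hab : a ^ 2 + β ^ 2 = 1)
    (h01 : reflLine a β d (q 0) = q 1) (h2 : reflLine a β d (q 2) = q 2)
    (h3 : reflLine a β d (q 3) = q 3) (h4 : reflLine a β d (q 4) = q 4) :
    ∃ s t y₃ y₄ y₅ : ℝ, q = t12Q s t y₃ y₄ y₅ := by
  have hy : (q 1).2 = (q 0).2 := by
    have := hq.2.2 (by norm_num) (by norm_num); simpa using this
  have hne : q 0 ≠ q 1 := hq.1 0 1 (by decide)
  have hx1 := congrArg Prod.fst h01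
  have hy1 := congrArg Prod.snd h01
  have hx2 := congrArg Prod.fst h2
  have hx3 := congrArg Prod.fst h3
  have hx4 := congrArg Prod.fst h4
  simp only [reflLine] at hx1 hy1 hx2 hx3 hx4
  have hsum := e32_sum_x_eq_zero hq
  -- the mirror is vertical: β = 0
  have hβ : β = 0 := by
    have hprod : (a * (q 0).1 + β * (q 0).2 - d) * β = 0 := by
      linear_combination (-1/2 : ℝ) * hy1 + (-1/2 : ℝ) * hy
    rcases mul_eq_zero.mp hprod with h | h
    · exfalso; apply hne
      refine Prod.ext ?_ ?_
      · rw [← hx1, h]; ring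
      · rw [← hy1, h]; ring
    · exact h
  subst hβ
  have ha : a ^ 2 = 1 := by simpa using hab
  -- abscissae
  have ex1 : (q 1).1 = -(q 0).1 + 2 * a * d := by
    linear_combination (-1 : ℝ) * hx1 + (-2 * (q 0).1) * ha
  have ex2 : (q 2).1 = a * d := by linear_combination (-1/2 : ℝ) * hx2 + (-(q 2).1) * ha
  have ex3 : (q 3).1 = a * d := by linear_combination (-1/2 : ℝ) * hx3 + (-(q 3).1) * ha
  have ex4 : (q 4).1 = a * d := by linear_combination (-1/2 : ℝ) * hx4 + (-(q 4).1) * ha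
  have had : a * d = 0 := by
    have : a * d * (2 + 2 * b + c) = 0 := by
      rw [ex1, ex2, ex3, ex4] at hsum; linear_combination hsum
    rcases mul_eq_zero.mp this with h | h
    · exact h
    · exact absurd h hM
  refine ⟨-(q 0).1, (q 0).2, (q 2).2, (q 3).2, (q 4).2, ?_⟩
  funext i
  fin_cases i
  · simp [t12Q]
  · simp only [t12Q]; refine Prod.ext ?_ ?_
    · simp; linarith [ex1, had]
    · simpa using hy
  · simp only [t12Q]; refine Prod.ext ?_ ?_
    · simp; linarith [ex2, had]
    · simp
  · simp only [t12Q]; refine Prod.ext ?_ ?_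
    · simp; linarith [ex3, had]
    · simp
  · simp only [t12Q]; refine Prod.ext ?_ ?_
    · simp; linarith [ex4, had]
    · simp

/-- A positive normalized central configuration of `(1,1,b,b,c)` (`2 + 2b + c ≠ 0`) mapped to itself by
a reflection exchanging the body pairs (1 2) and (3 4) and fixing body 5 is of the `T1234` shape.
[folklore] -/
theorem exists_t1234Q_of_reflection {b c : ℝ} (hM : 2 + 2 * b + c ≠ 0) {q : Fin 5 → ℝ × ℝ}
    (hq : IsPositiveNormalizedCC (e32Masses b c) q) {a β d : ℝ} (hab : a ^ 2 + β ^ 2 = 1)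
    (h01 : reflLine a β d (q 0) = q 1) (h23 : reflLine a β d (q 2) = q 3)
    (h4 : reflLine a β d (q 4) = q 4) :
    ∃ a₁ t₁ a₃ t₃ t₅ : ℝ, q = t1234Q a₁ t₁ a₃ t₃ t₅ := by
  have hy : (q 1).2 = (q 0).2 := by
    have := hq.2.2 (by norm_num) (by norm_num); simpa using this
  have hne : q 0 ≠ q 1 := hq.1 0 1 (by decide)
  have hx1 := congrArg Prod.fst h01
  have hy1 := congrArg Prod.snd h01
  have hx3 := congrArg Prod.fst h23
  have hy3 := congrArg Prod.snd h23
  have hx4 := congrArg Prod.fst h4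
  simp only [reflLine] at hx1 hy1 hx3 hy3 hx4
  have hsum := e32_sum_x_eq_zero hq
  have hβ : β = 0 := by
    have hprod : (a * (q 0).1 + β * (q 0).2 - d) * β = 0 := by
      linear_combination (-1/2 : ℝ) * hy1 + (-1/2 : ℝ) * hy
    rcases mul_eq_zero.mp hprod with h | h
    · exfalso; apply hne
      refine Prod.ext ?_ ?_
      · rw [← hx1, h]; ring
      · rw [← hy1, h]; ring
    · exact h
  subst hβ
  have ha : a ^ 2 = 1 := by simpa using hab
  have ex1 : (q 1).1 = -(q 0).1 + 2 * a * d := by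
    linear_combination (-1 : ℝ) * hx1 + (-2 * (q 0).1) * ha
  have ex3 : (q 3).1 = -(q 2).1 + 2 * a * d := by
    linear_combination (-1 : ℝ) * hx3 + (-2 * (q 2).1) * ha
  have ey3 : (q 3).2 = (q 2).2 := by linear_combination (-1 : ℝ) * hy3
  have ex4 : (q 4).1 = a * d := by linear_combination (-1/2 : ℝ) * hx4 + (-(q 4).1) * ha
  have had : a * d = 0 := by
    have : a * d * (2 + 2 * b + c) = 0 := by
      rw [ex1, ex3, ex4] at hsum; linear_combination hsum
    rcases mul_eq_zero.mp this with h | h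
    · exact h
    · exact absurd h hM
  refine ⟨-(q 0).1, (q 0).2, -(q 2).1, (q 2).2, (q 4).2, ?_⟩
  funext i
  fin_cases i
  · simp [t1234Q]
  · simp only [t1234Q]; refine Prod.ext ?_ ?_
    · simp; linarith [ex1, had]
    · simpa using hy
  · simp [t1234Q]
  · simp only [t1234Q]; refine Prod.ext ?_ ?_
    · simp; linarith [ex3, had]
    · simpa using ey3
  · simp only [t1234Q]; refine Prod.ext ?_ ?_
    · simp; linarith [ex4, had]
    · simp

end Literature.Dynamics.NBody
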